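import Literature.NumberTheory.EllipticCurves.BurungaleSkinnerTianWan2024.SignedTwoVariableDescentPackagePRE
import Literature.NumberTheory.EllipticCurves.GrossPointsThetaElementSupersingular
import Literature.NumberTheory.EllipticCurves.GreenbergVatsal2000.CongruentCurves
import HarnessLib

/-!
# Burungale–Skinner–Tian–Wan (arXiv:2409.01350v2, PREPRINT), Part II §10.2.2 Thm. 10.5 (label
# `KoMC'_lb`, "An Eisenstein congruence divisibility"; = Thm. 2.5 of §2.2.2 in the Part-relative
# numbering of the TeX store), PROOF, case (def) = (10.1): the comparison
# `(𝓛^{∘,ac}_p(g_{/L})) = (∏_{q ∣ N⁻} c_q(g) · 𝓛^∘_𝒲(g_{/L}))` pinning the anticyclotomic line of the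
# two-variable signed `p`-adic `L`-function of Props. 9.18 / 10.7 / 6.19 (store: 1.18 / 2.7 / 5.19 —
# the tree's PRE package `props118_27_519_…`) to the definite-quaternion (Gross-point) signed
# anticyclotomic `p`-adic `L`-function of Darmon–Iovita / Pollack–Weston, whose finite layers are the
# tree's `GrossPointTower.lAc` ("`L_n`") — as ONE explicitly labelled OPEN binder (claim-tagged;
# NEVER a fact), in the `μ`-currency fixed by the consumer

Typer seat `bsd-armP-typer-04-g0` (literature-prover, 2026-08-29; forest fact F048, key
«MANUAL:BSTW2024_II_2_2_2_definitePackage_pinning») of cell `bsd-ssimc` (run/shared/lean/pub/bsd-ssimc/),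
for route `SignedLowerHalves` of the BSD summit, crux 2 = item stmt-BirchSwinnertonDyer-19000
`KobayashiLowerHalfSemistable`, registered line «defmu» (skeleton v4), HARD stub Cμ′ =
`stub_definitePackageMuCarrier` (`Cruxes/KobayashiLowerHalfSemistable/Lines/defmu.lean`), whose LEAD
(bsd-line-slh-p2 gen 13, `Lines/defmu.md` v3/v4, `PICKED.md` addendum 7) located the ONE untyped input of
the line as: «ONE PRE binder for the (P4b) comparison in the currency `T.HasMuZeroLAc p φ → HasUnitContent
(UnrSeries₂.minus Lsig)` over a carrier `(S : Brandt.XiSetup (N/q₀) q₀, φ generator, T)`» — the literal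
ring-hom "pinning" currency (`∃ λ ρ_n, ρ_n(u_n λ) = s_n • L_n`, the hypothesis shape of
`GrossPointTower.HasMuZeroLAc.hasUnitContent_of_pinned`) having been typed and ABANDONED there because
`PowerSeries ℤ_[p] →+* MonoidAlgebra ℤ_[p] (AcLayerGroup K p (n+1))` does not elaborate under the BSTW
import closure. Conventions VERBATIM those of the sibling binders of this directory
(`props118_27_519_exists_signedTwoVariablePackage_supersingular_PRE`, `prop627_span_minus_eq_span_bdp_
supersingular_PRE`, `thm617_…_PRE`, `thm924_…_OPEN`): UNREFEREED preprint ⇒ an explicitly labelled OPEN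
hypothesis (`def … : Prop`, `[claim: …, status: under-review]`), NEVER a theorem, NEVER a `[cite:]`-fact,
no `_holds`; nothing is asserted about any curve; nothing is booked; BSD / the crux is NOT proved by typing.
ZERO new notions: §1 is ONE binder; §2 is bookkeeping PROVED (the binder delivers the registered stub's
shape once a carrier is supplied; the package of the sibling binder is a projection of this one).

## The printed statements (PDF arXiv:2409.01350v2 of 11 Sep 2024, pp. 87–88; store text
## `paper:arxiv-2409.01350` = the TeX in 3 000-char pages `pNNNN`; printed numbers from the litref
## concordance `pub/bsd-litref/bstw24/sheets/LABELS-bstw24-v2.tsv`)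

* **Thm. 10.5** (label `KoMC'_lb`; PDF p. 87; store p0075 L92–L115): "§10.2.2 An Eisenstein congruence
  divisibility. Let `g ∈ S₂(Γ₀(N))` be an elliptic newform with `N` square-free and `p ∤ 2N` a prime.
  Let `L` be an imaginary quadratic field satisfying `(D_L, 2N) = 1` and (ord). In the ordinary case
  suppose that (irr_L) holds. Write `N = N⁺N⁻` for `N⁺` precisely divisible by split primes in `L`.
  Suppose that either (def) Each prime dividing `N⁻` satisfies (ram) and `ν(N⁻)` is odd, or (indef) Each
  prime dividing `N⁻ ≠ 1` satisfies (ram) and `ν(N⁻)` is even. Then for `∘ ∈ {+, −, ∅}`, one has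
  `𝓛^∘_p(g_{/L}) ∣ ξ(X_∘(g_{/L}))` in `Λ_{L,𝒪_λ}`. …" — (ram) [Thm. 9.21 (c), store p0073 L24–L26]:
  "There exists a prime `ℓ ∥ N` with `ρ̄` ramified at `ℓ`" (here required of EACH `q ∣ N⁻`).
* **Its proof, case (def)** (PDF p. 88; store p0075 L137 – p0076 L10), VERBATIM: "Suppose that (def)
  holds. Then `ε(g_{/L}) = +1`, and `μ(𝓛^∘_𝒲(g_{/L})) = 0` by [PW] (PDF: [116, Thm. 1.2]). Here
  `𝓛^∘_𝒲(g_{/L})` is the `∘`-anticyclotomic `p`-adic `L`-function whose construction is based on the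
  Waldspurger formula on the definite quaternion algebra ramified at the primes dividing `N⁻∞` (see
  also [Va]). In view of the interpolation formulas for the underlying `p`-adic `L`-functions, it
  follows that `(𝓛^{∘,ac}_p(g_{/L})) = (∏_{q ∣ N⁻} c_q(g) · 𝓛^∘_𝒲(g_{/L}))`. Note that the Tamagawa
  numbers `c_q(g)` are `p`-indivisible under the hypothesis (ram), and so `μ(𝓛^∘_p(g_{/L})) = 0`. Hence
  `𝓛^∘_p(g_{/L})` is coprime to height one prime ideals of `Λ^{cyc}_{L,𝒪_λ}`, and the divisibility
  (tpm-div) holds in `Λ_L`."  THIS FILE TYPES THE DISPLAYED COMPARISON (the sentence "it follows that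
  …"), which is BSTW's own, unrefereed step; `μ(𝓛^∘_𝒲) = 0` is Pollack–Weston 2011 Thm. 2.5 (i),
  PUBLISHED, the tree's named fact `pollackWeston2011_thm_2_5_hasMuZeroLAc` (consumed BY NAME by the
  line's stub `stub_acMuInput`, not restated here).
* The objects: `𝓛^∘_p(g_{/L}) = 𝒞_∘(loc_p(𝓑𝓕^∘(g_{/L}))) ∈ J_g ⊗ 𝓡` (Part I §6.2.1; store §5.2.1,
  p0050 L50–L73), `𝓛^{∘,ac}_p` its image modulo `(γ_cyc − 1)` (§4.1.4–4.1.5; store §3.1.4–3.1.5, p0027 L1–L24: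
  `Γ_L^+ ≅ Γ_L^cyc`, `Γ_L^- ≅ Γ_L^ac`); `𝓛^∘_𝒲(g_{/L})` = the `λ_f^±`/`L_f^±` of [DarmonIovita2008, §2.2] / [PollackWeston2011,
  §2.4], built from the elements `L_n ∈ ℤ_p[G̃_{n+1}/Δ]` of a tower of Gross points on the definite
  quaternion algebra of discriminant `N⁻` with an Eichler order of level `N⁺`
  (`L_n = ω̃_n^{−ε} L_n^ε`, `L_f^ε = lim ±L_n^ε`: DI Prop. 2.8, Lemma 2.9) — the tree's
  `GrossPointTower.lAc p φ T n` (file `GrossPointsThetaElementSupersingular`, whose docstring proves the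
  dictionary `[μ(λ_f^+) = 0 ∧ μ(λ_f^-) = 0] ⟺ [μ(L_n) = 0 for all n ≫ 0] = GrossPointTower.HasMuZeroLAc`
  from DI Lemma 2.7 (2)).

## Transcription (elliptic-curve instance `g = f_E`, `L = K`, `𝒪_λ = ℤ_p`) — the sibling package's
## binders VERBATIM, plus the datum of Thm. 10.5 / (def), plus ONE conjunct

BINDERS = those of `props118_27_519_exists_signedTwoVariablePackage_supersingular_PRE`, byte for byte
(`W/ℚ` globally minimal with newform `f` of level `N = N_E`; `p` odd, `p ∤ N_E`, `a_p(E) = 0`; `K`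
imaginary quadratic, (ord) `#primesOver p = 2`, `p ∈ v`, `p ∈ v̄`, `v̄ ≠ v`, `v` induced by `ι`;
(coprime) `IsCoprime N D_K`; (irr_K) in K1′'s spelling; the `ℤ_p²`-tower `(κ₁, κ₂; γ₁, γ₂)` =
(cyclotomic OUTER `T₁`, anticyclotomic INNER `T₂`); a Katz frame `(Ω, δ, Ω_p, LK)` with a Greenberg
series `G`; a structure map `J` with its compatibility clause; a Kobayashi sign `ε`), with, inserted
after (coprime), THE DATUM OF THM. 10.5 / (def): `Squarefree N` ("`N` square-free"), `Odd D_K` (with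
(coprime): "`(D_L, 2N) = 1`"), a factorisation `N = N⁺N⁻` (`Nplus * Nminus = N`) with every prime of
`N⁺` split and every prime of `N⁻` inert in `K` ("`N⁺` precisely divisible by split primes"; under
(coprime) non-split = inert), (ram) at every `q ∣ N⁻` in the model's spelling `p ∤ v_q(Δ_W)` (for the
globally minimal `W`, `q ∥ N`, `q ≠ p` odd-`p`: `ρ̄_{E,p}` is ramified at `q` iff `p ∤ v_q(Δ_min)` — Tate
curve; the spelling of the line's stub S1aʳ `stub_ramifiedLevelPrimeR` and of BSTW's own gloss "the
Tamagawa numbers `c_q(g)` are `p`-indivisible under (ram)"), and `ν(N⁻)` odd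
(`Odd Nminus.primeFactors.card`).
CONCLUSION: there are `ξ_∘, 𝓛^∘ ∈ 𝒪_{ℂ_p}⟦T₁⟧⟦T₂⟧` with
* (PIN) — NEW, the content of this file — for EVERY definite carrier of type `(N⁺, N⁻)`: every Brandt
  setup `S : Brandt.XiSetup Nplus Nminus` (the definite quaternion algebra ramified exactly at the primes
  of `N⁻`, with an Eichler order of level `N⁺`), every generator `φ ≠ 0` of the `a(E)`-eigen-line of its
  Brandt module (`Brandt.eigenLattice (N⁺N⁻) (Brandt.matrix S.O) (a_n(E)) = ℤ ∙ φ`: the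
  Jacquet–Langlands vector `g_f` of [PW] §2.1 / the form `f` of [DI] Thm. 2.2) and every tower `T` of
  Gross points of `p`-power conductor (`GrossPointTower K S p`):
  `T.HasMuZeroLAc p φ → GreenbergVatsal2000.HasUnitContent (UnrSeries₂.minus 𝓛^∘)` — "if `μ(L_n) = 0`
  for all large `n` then the anticyclotomic line `𝓛^∘(0, T₂)` of `𝓛^∘` has a unit coefficient
  (`μ = 0`)"; `UnrSeries₂.minus = PowerSeries.constantCoeff` kills the OUTER, cyclotomic, variable `T₁`
  = "modulo `(γ_cyc − 1)`", exactly as in the sibling `prop627_…_PRE` and in the line's stub;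
* (P1) ∧ (P2) ∧ (P3) — the sibling package VERBATIM (Prop. 9.18 identity form; Prop. 10.7 "in
  particular" and Prop. 6.19 + (sspLcy) + dictionary on the cyclotomic line).
WHY (PIN) IS WEAKER-OR-EQUAL TO PRINT (granted the published inputs it names): print gives the IDEAL
EQUALITY `(𝓛^{∘,ac}_p) = (c · 𝓛^∘_𝒲)` with `c = ∏_{q ∣ N⁻} c_q(g)` a `p`-adic unit under (ram) (print's
own remark), hence `μ(𝓛^{∘,ac}_p) = μ(𝓛^∘_𝒲)`; and `μ(𝓛^+_𝒲) = μ(𝓛^-_𝒲) = 0 ⟺ T.HasMuZeroLAc p φ` for the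
carrier `(S, φ, T)` from which `𝓛_𝒲 = λ_f` is built (DI Prop. 2.8 / Lemma 2.7 (2); any carrier of type
`(N⁺, N⁻)`: `φ` is unique up to sign by multiplicity one — the tree's PROVED
`takahashi2001_brandtEigenLattice_rank_one_holds` —, towers differ by the `G̃_∞`-action and the
orientations, which move `L_n` by units of the group ring / the involution, and Eichler orders of level
`N⁺` form one genus). So print ⟹ [for every carrier: `HasMuZeroLAc → μ(𝓛^{∘,ac}_p) = 0`]; (PIN) keeps ONE
direction, the `μ`-invariant only, and asks `μ = 0` of BOTH parities of `L_n` at once (stronger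
hypothesis) — the "μ-shadow" of the comparison, literally the registered stub's conjunct. The typed
avatar `UnrSeries₂.minus 𝓛^∘ ∈ 𝒪_{ℂ_p}⟦T⟧` differs from print's `𝓛^{∘,ac}_p ∈ Λ^{ac}_{L,ℤ_p}` by the
structure map `J` and (READING FLAG `BSTW-2VS-frame`, inherited) by a unit of `𝒪_{ℂ_p}⟦T₁,T₂⟧`; unit
content is invariant under both (`hasUnitContent_map_iff_of_coe_eq`, `hasUnitContent_mul_iff_of_isUnit`,
file `Hida2010MuInvariant/AnticyclotomicKatzBranchMuInvariant` / `Rubin1991/TwoVariableCMLines`).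

READING FLAGS (cell readings, NOT in print — why the binder is claim-tagged twice over): `BSTW-2VS-frame`,
`BSTW-2VS-signs`, `BSTW-2VS-XGr`, `BSTW-2VS-coords`, `BSTW-2VS-reader` of the sibling
`SignedTwoVariableDescentPackagePRE.lean`, inherited VERBATIM (the (P1)–(P3) clauses are that file's);
NEW flag `BSTW-105-carrier`: print's "`𝓛^∘_𝒲(g_{/L})` … whose construction is based on the Waldspurger
formula on the definite quaternion algebra ramified at the primes dividing `N⁻∞` (see also [Va])", with
`μ = 0` "by [PW]", is READ as the Darmon–Iovita / Pollack–Weston function `λ_f^∘` of ANY definite carrier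
`(S, φ, T)` of type `(N⁺, N⁻)` through its finite layers `L_n` (the only typed avatar: the tree has no
`ℤ_p⟦T⟧ ≅ lim ℤ_p[G_n]`, documented gap of `GrossPointsThetaElement`), and the sign dictionary
`∘ ↔ ±` ([BSTW] §6.1.1 footnote, store §5.1.1 p0049 L59: "our labelling of signs is opposite to [Po], …
consistent with [Ko]"; DI's `ε = sgn (−1)^n`) is immaterial because `HasMuZeroLAc` carries both parities.

WHAT IS NOT CLAIMED: the ideal equality itself (no `Λ`-level `𝓛_𝒲` exists in the tree), its converse
direction, anything about `λ`-invariants or Tamagawa numbers, the (indef)/BDP twin (store p0076 L12;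
cf. the sibling `prop627_…_PRE`), the case `∘ = ∅` (ordinary; Bertolini–Darmon / Vatsal), `ε(g_{/L}) = +1`,
Thm. 10.5's conclusion (tpm-div) or Thm. 10.1; no carrier is asserted to EXIST (that is PUBLISHED and
typed elsewhere: `nonempty_xiSetup_of_prime`, `takahashi2001_brandtEigenLattice_rank_one_holds`,
`nonempty_grossPointTower_holds`); nothing at `p = 2`, for `a_p ≠ 0`, for `p` non-split or `(D_K, 2N) ≠ 1`;
the `𝒪_λ ≠ ℤ_p` generality (TODO(general form): non-rational newforms — the Brandt module of the tree is
`ℤ`-valued, as in `pollackWeston2011_thm_2_5_hasMuZeroLAc`). No `_holds`.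

CONSUMER: `stub_definitePackageMuCarrier` (Cμ′, v4) of line «defmu» on stmt-BirchSwinnertonDyer-19000 is
`exists_muCarrier_of_pinned` below applied to this binder at `(N⁺, N⁻) = (N/q₀, q₀)` and to ANY carrier
(carriers exist by the three proved/named existence results above; the datum bridges `ClassX6 ⇒ N_E`
square-free and "`2` split or `2 ∣ N`" ⇒ `D_K` odd — `Quadratic.ncard_primesOver_two_eq_two_iff` — are the
consumer's, as in `SemistableDefmuMuCarrier.hasMuZeroLAc_of_pollackWeston`).

presearch (2026-08-29, both corpora): tree — none (`rg` over `Literature/` for `UnrSeries₂.minus`,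
`HasMuZeroLAc`, `pinned`, `c_q`, `Waldspurger … definite`: only the sibling (indef)/BDP binder
`prop627_…_PRE` and the Gross-points files; no def of this comparison); corpus `lit search --hybrid` /
`lit vsearch` ("two-variable plus/minus p-adic L-function supersingular anticyclotomic restriction definite
quaternion Darmon–Iovita Tamagawa") → none relevant (Delbourgo 2008, Kriz 2021, Lang: generic hits);
galaxy `"anticyclotomic restriction|definite quaternion algebra ramified|signed Beilinson"`,
`"plus/minus anticyclotomic|Darmon-Iovita"` --star all/pdf → [galaxy:pdf] Büyükboduk–Lei–Loeffler–Venkat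
ANT 13 (2019) (Rankin–Selberg non-ordinary; not this comparison), nothing else. No refereed source prints
the (def) comparison at a supersingular prime; lit FRESHNESS 2026-08-29: arXiv API lists v2
(2024-09-11) as latest, no journal version.

## References
* [BurungaleSkinnerTianWan2024] A. Burungale, C. Skinner, Y. Tian, X. Wan, *Zeta elements for elliptic
  curves and applications*, arXiv:2409.01350v2, 11 Sep 2024 (PREPRINT, unrefereed): Part II §10.2.2
  Thm. 10.5 (label KoMC'_lb; PDF p. 87) and its proof, case (def) = (10.1) (PDF p. 88; TeX store
  p0075 L92 – p0076 L13); Thm. 9.21 (c) for (ram) (p0073 L24–L26); Props. 9.18 / 10.7 / 6.19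
  (store 1.18 / 2.7 / 5.19: the sibling package); §6.2.1 (store §5.2.1, p0050), §4.1.4–4.1.5 (store
  §3.1.4–3.1.5, p0027), §6.1.1 footnote on signs (store §5.1.1, p0049 L59). (The TeX store numbers
  Part I sections one lower and Part II sections Part-relatively; printed numbers from the concordance.)
* [PollackWeston2011] R. Pollack, T. Weston, Compos. Math. 147 (2011), §2.1, §2.4 Thm. 2.5 — the tree's
  `pollackWeston2011_thm_2_5_hasMuZeroLAc` (PUBLISHED; not restated).
* [DarmonIovita2008] H. Darmon, A. Iovita, J. Inst. Math. Jussieu 7 (2008), §2.2 (L̃_n, L_n, Lemma 2.7,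
  Prop. 2.8, Lemma 2.9) — the tree's `GrossPointTower.lTilde` / `lAc` / `HasMuZeroLAc`.
* [Vatsal1999] V. Vatsal, *Canonical periods and congruence formulae*, Duke Math. J. 98 (1999) —
  print's "[Va]" (store p0088 L43); PDF v2 cites `μ(𝓛_𝒲) = 0` as "[116, Thm. 1.2]" = [PW].
* Tree: `BurungaleSkinnerTianWan2024/SignedTwoVariableDescentPackagePRE.lean` (the package and its
  currency), `GrossPointsThetaElementSupersingular.lean` (the carrier currency),
  `GreenbergVatsal2000/CongruentCurves.lean` (`HasUnitContent`), `Summits/…/Cruxes/KobayashiLowerHalf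
  Semistable/Lines/defmu.lean` v4 and `Theorems/…DefmuMuCarrier{,V4}.lean` (the consumer — NOT imported).
-/

noncomputable section

open scoped Classical

open NumberField IsDedekindDomain Field CongruenceSubgroup
  Literature.NumberTheory.GaloisRepresentations Literature.NumberTheory.EllipticCurves
  Literature.NumberTheory.EllipticCurves.ModularForms Literature.NumberTheory.Automorphic

namespace Literature.NumberTheory.EllipticCurves.BurungaleSkinnerTianWan2024

/-! ### §1. The binder -/

/-- **OPEN HYPOTHESIS — UNREFEREED PREPRINT (arXiv:2409.01350v2, 11 Sep 2024), Part II Thm. 10.5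
(label `KoMC'_lb`, §10.2.2 "An Eisenstein congruence divisibility"; store numbering Thm. 2.5, §2.2.2),
PROOF, case (def): "In view of the interpolation formulas for the underlying `p`-adic `L`-functions, it
follows that `(𝓛^{∘,ac}_p(g_{/L})) = (∏_{q ∣ N⁻} c_q(g) · 𝓛^∘_𝒲(g_{/L}))`. Note that the Tamagawa numbers
`c_q(g)` are `p`-indivisible under the hypothesis (ram)" (PDF p. 88), where "`𝓛^∘_𝒲(g_{/L})` is the
`∘`-anticyclotomic `p`-adic `L`-function whose construction is based on the Waldspurger formula on the
definite quaternion algebra ramified at the primes dividing `N⁻∞`" — typed as the two-variable signed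
descent package of the sibling binder `props118_27_519_exists_signedTwoVariablePackage_supersingular_PRE`
(binders VERBATIM) AT THE DATUM OF THM. 10.5 / (def) (`N = N_E` square-free, `D_K` odd — so
`(D_K, 2N) = 1` —, `N = N⁺N⁻` with the primes of `N⁺` split and of `N⁻` inert in `K`, (ram) at every
`q ∣ N⁻`: `p ∤ v_q(Δ_E)` for the minimal model, `ν(N⁻)` odd), WITH ONE MORE CONJUNCT on the same `𝓛^∘`:
(PIN) for every definite carrier of type `(N⁺, N⁻)` — Brandt setup `S`, generator `φ ≠ 0` of the
`a(E)`-eigen-line of its Brandt module, tower `T` of Gross points of `p`-power conductor — "`μ(L_n) = 0`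
for all large `n`" (`T.HasMuZeroLAc p φ`, Darmon–Iovita's `L_n`, the finite layers of `𝓛_𝒲 = λ_f^±`)
implies that the anticyclotomic line `UnrSeries₂.minus 𝓛^∘` ("modulo `(γ_cyc − 1)`") has a unit
coefficient (`GreenbergVatsal2000.HasUnitContent`: `μ(𝓛^{∘,ac}_p) = 0`).** The `μ`-SHADOW of the printed
ideal equality (one direction, `μ` only, both parities of `L_n` assumed: WEAKER than print granted the
published dictionary `μ(λ_f^+) = μ(λ_f^-) = 0 ⟺ HasMuZeroLAc`, DI Lemma 2.7 (2) / Prop. 2.8, and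
multiplicity one), in exactly the currency of the registered stub `stub_definitePackageMuCarrier` (v4) of
line «defmu» on stmt-BirchSwinnertonDyer-19000 (see `exists_muCarrier_of_pinned`). READING FLAGS
`BSTW-2VS-frame` / `-signs` / `-XGr` / `-coords` / `-reader` (inherited) and `BSTW-105-carrier` of the
module docstring. Pollack–Weston's `μ(𝓛_𝒲) = 0` is NOT part of this binder (named fact
`pollackWeston2011_thm_2_5_hasMuZeroLAc`, by name); no carrier is asserted to exist. NEVER cite this
`Prop` as a theorem; no `_holds`.
[claim: BurungaleSkinnerTianWan2024, status: under-review]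
[cite: BurungaleSkinnerTianWan2024, Part II Thm. 10.5 (label KoMC'_lb) proof, case (def) = (10.1) (PDF v2 p. 88; arXiv v2 TeX store p0075 L137 – p0076 L10), with Thm. 10.5's hypotheses (PDF p. 87; p0075 L92–L115) and (ram) of Thm. 9.21 (c) (p0073 L24–L26); Props. 9.18 / 10.7 / 6.19 as in the sibling package (ANNOUNCED, OPEN binder)] [cite: DarmonIovita2008, §2.2 Prop. 2.8 and Lemma 2.7 (2) (the finite layers L_n of 𝓛_𝒲)] [cite: PollackWeston2011, §2.1 and §2.4 (the carrier (B, R, g_f) of type (N⁺, N⁻))] -/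
def thm105def_exists_signedTwoVariablePackage_pinnedToGrossPoints_supersingular_PRE : Prop :=
  ∀ {p : ℕ} [Fact p.Prime] (ι : PadicAlgCl p ≃+* ℂ) (W : WeierstrassCurve ℚ) [W.IsElliptic]
    [W.IsGloballyMinimal] (K : Type) [Field K] [NumberField K] (v vbar : HeightOneSpectrum (𝓞 K))
    (κ₁ κ₂ : ZpExtension K p) (γ₁ γ₂ : absoluteGaloisGroup K)
    [Fact (ZpExtension.IsTopGeneratorPair κ₁ κ₂ γ₁ γ₂)] {N : ℕ} [NeZero N] (f : CuspForm (Gamma0 N) 2)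
    [NeZero (NumberField.discr K).natAbs],
    -- `g = f_E` of level `N = N_E`; `p ∤ 2N` supersingular: `p` odd, `p ∤ N_E`, `a_p(E) = 0`
    IsNewformOf W f → (N : ℤ) = W.conductorNorm ℤ → p ≠ 2 → ¬ (p : ℤ) ∣ W.conductorNorm ℤ →
    W.frobeniusTrace p = 0 →
    -- `L = K` imaginary quadratic; (ord) `p = v v̄` split, `v` induced by `ι`; (coprime) `(N, D_K) = 1`
    IsImaginaryQuadratic K → ((Ideal.span {(p : ℤ)}).primesOver (𝓞 K)).ncard = 2 →
    ((p : ℕ) : 𝓞 K) ∈ v.asIdeal → ((p : ℕ) : 𝓞 K) ∈ vbar.asIdeal → vbar ≠ v →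
    (∀ (w : InfinitePlace K) (k : 𝓞 K), k ∈ v.asIdeal ↔ ‖ι.symm (w.embedding (k : K))‖ < 1) →
    IsCoprime (N : ℤ) (NumberField.discr K) →
    -- THE DATUM OF THM. 10.5 / (def): `N` square-free; `D_K` odd (so `(D_K, 2N) = 1`); `N = N⁺N⁻` with
    -- the primes of `N⁺` split and of `N⁻` inert in `K`; (ram) at every `q ∣ N⁻`; `ν(N⁻)` odd
    Squarefree N → Odd (NumberField.discr K) →
    ∀ (Nplus Nminus : ℕ), Nplus * Nminus = N →
      (∀ ℓ : ℕ, ℓ.Prime → ℓ ∣ Nplus → ((Ideal.span {(ℓ : ℤ)}).primesOver (𝓞 K)).ncard = 2) →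
      (∀ ℓ : ℕ, ℓ.Prime → ℓ ∣ Nminus → ((Ideal.span {(ℓ : ℤ)}).primesOver (𝓞 K)).ncard = 1) →
      (∀ q : ℕ, q.Prime → q ∣ Nminus → ¬ ((p : ℤ) ∣ padicValRat q W.Δ)) →
      Odd Nminus.primeFactors.card →
    -- (irr_K), K1′'s spelling (⇒ (van_K) of Prop. 9.18, (irr_ℚ) of Prop. 6.19 (ii))
    (∀ ρ : ModPGaloisRep K (ZMod p) 2, (W.baseChange K).IsTorsionGaloisRep p ρ →
      FramedRep.IsAbsolutelyIrreducible ρ) →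
    -- the `ℤ_p²`-tower: `κ₁` cyclotomic (outer variable `T₁`), `κ₂` anticyclotomic (inner `T₂`)
    κ₁.IsCyclotomic → κ₂.IsAnticyclotomic →
    -- a Katz frame and a Greenberg series `G = 𝓛_p^Gr(f/K)` over it (VERBATIM the sibling package)
    ∀ (Ω δ : ℂ) (Ωp : (unrIntegers p)ˣ) (LK G : PowerSeries (PowerSeries (PadicComplexInt p))),
      Ω ≠ 0 → (δ ^ 2 = (NumberField.discr K : ℂ) ∨ δ ^ 2 = -(NumberField.discr K : ℂ)) →
      IsKatzMeasure₂ ι v vbar ∅ κ₁ κ₂ γ₁⁻¹ γ₂⁻¹ 1 Ω δ ((Ωp : unrIntegers p) : PadicComplex p) LK →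
      IsGreenbergLFunctionAnyRoot₂ ι v vbar κ₁ κ₂ γ₁⁻¹ γ₂⁻¹ f (NumberField.discr K).natAbs
        (NumberField.classNumber K) LK G →
    -- a structure map `J : ℤ_p → 𝒪_{ℂ_p}` with its compatibility clause (VERBATIM the sibling package)
    ∀ J : ℤ_[p] →+* PadicComplexInt p,
      (∀ x : ℤ_[p], ((J x : PadicComplexInt p) : PadicComplex p) = ((x : ℚ_[p]) : PadicComplex p)) →
    -- a sign, in KOBAYASHI's labelling
    ∀ ε : ℤˣ,
    ∃ xi Lsig : PowerSeries (PowerSeries (PadicComplexInt p)),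
      -- (PIN) Thm. 10.5 proof, case (def): the `μ`-shadow of `(𝓛^{∘,ac}_p) = (∏ c_q · 𝓛^∘_𝒲)` — for
      -- every definite carrier `(S, φ, T)` of type `(N⁺, N⁻)`, `μ(L_n) = 0 (n ≫ 0) ⟹ μ(𝓛^∘(0, T₂)) = 0`
      (∀ (S : Brandt.XiSetup Nplus Nminus) [Fintype (Brandt.ClassSet S.O)]
          (φ : Brandt.ClassSet S.O → ℤ) (T : GrossPointTower K S p), φ ≠ 0 →
          Brandt.eigenLattice (Nplus * Nminus) (Brandt.matrix S.O) (fun n => W.LFunction n) = ℤ ∙ φ →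
          T.HasMuZeroLAc p φ → GreenbergVatsal2000.HasUnitContent (UnrSeries₂.minus Lsig)) ∧
      -- (P1) Prop. 9.18, identity form: `(ξ_∘ · 𝓛^Gr) = Char(X_Gr)^{ur} · (𝓛^∘)` (VERBATIM the sibling)
      (Ideal.span {xi * G} =
          (WeierstrassCurve.XGr₂.charIdeal (W.baseChange K) p κ₁ κ₂ vbar γ₁ γ₂).map
              (IwasawaAlgebra₂.toUnr₂ p J) * Ideal.span {Lsig} ∧
      -- the cyclotomic line (VERBATIM the sibling): canonical `(κ, γ)` over `ℚ` matching `γ₁`, a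
      -- globally minimal model `W₂` of `E^{(D_K)}`; (P2) Prop. 10.7 "in particular"; (P3) Prop. 6.19 +
      -- (sspLcy) + dictionary
      ∀ (κ : ZpExtension ℚ p) (γ : absoluteGaloisGroup ℚ), κ.IsCyclotomic → κ.IsTopGenerator γ →
        IsCyclotomicVariable p γ →
        (∃ ζ : ℤ_[p]ˣ, IsOfFinOrder ζ ∧
          GaloisRep.cyclotomicCharacter ℚ p γ * ζ = GaloisRep.cyclotomicCharacter K p γ₁) →
        ∀ (W₂ : WeierstrassCurve ℚ) [W₂.IsElliptic] [W₂.IsGloballyMinimal]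
          (C₂ : WeierstrassCurve.VariableChange ℚ),
          C₂ • W₂ = W.quadraticTwist (NumberField.discr K : ℚ) →
          (∀ (D₁ : Kobayashi2003.SignedSelmerDualData W κ γ ε)
              (D₂ : Kobayashi2003.SignedSelmerDualData W₂ κ γ ε) (g₁ g₂ : IwasawaAlgebra p),
              D₁.charIdeal = Ideal.span {g₁} → D₂.charIdeal = Ideal.span {g₂} →
              UnrSeries₂.plus xi ∣ PowerSeries.map J (g₁ * g₂)) ∧
          (∀ {N₂ : ℕ} [NeZero N₂] (f₂ : CuspForm (Gamma0 N₂) 2), IsNewformOf W₂ f₂ →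
            ∀ (L₁ L₂ : IwasawaAlgebra p), Kobayashi2003.IsSignedPAdicLFunction f p ε L₁ →
              Kobayashi2003.IsSignedPAdicLFunction f₂ p ε L₂ →
              ∃ u : PowerSeries (PadicComplexInt p), IsUnit u ∧
                UnrSeries₂.plus Lsig = u * PowerSeries.map J (L₁ * L₂)))

/-! ### §2. Bookkeeping (PROVED): the one-inert-prime datum of the consumer, and the registered stub's
shape from the binder and a carrier -/

section Consumer

/-- A prime `q₀` dividing a square-free `N` divides it exactly: `q₀² ∤ N` (private plumbing). [folklore] -/
private theorem not_sq_dvd_of_squarefree_of_prime {N q₀ : ℕ} (hsq : Squarefree N) (hq₀ : q₀.Prime) :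
    ¬ (q₀ ^ 2 ∣ N) := fun h =>
  hq₀.not_isUnit (hsq q₀ (by simpa [sq] using h))

/-- For `q₀ ∥ N` the primes of `N / q₀` are the primes `ℓ ∣ N` with `ℓ ≠ q₀` (private plumbing; the
consumer's public copy is `SemistableDefmuMuCarrier.ne_of_dvd_div`). [folklore] -/
private theorem dvd_and_ne_of_dvd_div {N q₀ ℓ : ℕ} (hqN : q₀ ∣ N) (hq2 : ¬ (q₀ ^ 2 ∣ N)) (hℓ : ℓ ∣ N / q₀) :
    ℓ ∣ N ∧ ℓ ≠ q₀ := by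
  refine ⟨hℓ.trans (Nat.div_dvd_of_dvd hqN), ?_⟩
  rintro rfl
  exact hq2 (by rw [sq]; exact (Nat.dvd_div_iff_mul_dvd hqN).mp hℓ)

/-- A prime has an odd number (one) of prime factors: `ν(q₀) = 1` (private plumbing). [folklore] -/
private theorem odd_card_primeFactors_of_prime {q₀ : ℕ} (hq₀ : q₀.Prime) : Odd q₀.primeFactors.card := by
  rw [hq₀.primeFactors, Finset.card_singleton]
  exact odd_one

/-- **The registered stub's shape from the binder and a carrier** (consumability / T2 dead-binder
certificate). At the datum of the line «defmu» — ONE bad prime `q₀ ∣ N` inert in `K`, every other prime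
of the square-free `N = N_E` split, (ram) at `q₀`, `D_K` odd — the binder, read at `(N⁺, N⁻) = (N/q₀, q₀)`
(`ν(N⁻) = 1` odd; the primes of `N/q₀` are the `ℓ ∣ N`, `ℓ ≠ q₀`), and ANY definite carrier `(S, φ, T)` of
type `(N/q₀, q₀)` deliver the conclusion of `stub_definitePackageMuCarrier` (v4) VERBATIM: the signed
two-variable package `(ξ_∘, 𝓛^∘)` together with a carrier whose `μ(L_n) = 0 (n ≫ 0)` forces
`μ(𝓛^∘(0, T₂)) = 0`. Carriers EXIST by published results typed elsewhere (`nonempty_xiSetup_of_prime`;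
multiplicity one `takahashi2001_brandtEigenLattice_rank_one_holds`; `nonempty_grossPointTower_holds`) —
not imported here; the remaining bridges of the stub's datum (`ClassX6 ⇒` semistable `⇒ N_E` square-free;
"`2` split or `2 ∣ N`" `⇒ D_K` odd) are the consumer's. CONDITIONAL on the OPEN binder `h`; closes
nothing; BSD / the crux NOT proved. [cite: BurungaleSkinnerTianWan2024, Part II Thm. 10.5 proof, case (def) (PDF v2 p. 88; TeX store p0075 L137 – p0076 L10) (shape; nothing asserted)] -/
theorem exists_muCarrier_of_pinned
    (h : thm105def_exists_signedTwoVariablePackage_pinnedToGrossPoints_supersingular_PRE)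
    {p : ℕ} [Fact p.Prime] (ι : PadicAlgCl p ≃+* ℂ) (W : WeierstrassCurve ℚ) [W.IsElliptic]
    [W.IsGloballyMinimal] (K : Type) [Field K] [NumberField K] (v vbar : HeightOneSpectrum (𝓞 K))
    (κ₁ κ₂ : ZpExtension K p) (γ₁ γ₂ : absoluteGaloisGroup K)
    [Fact (ZpExtension.IsTopGeneratorPair κ₁ κ₂ γ₁ γ₂)] {N : ℕ} [NeZero N] (f : CuspForm (Gamma0 N) 2)
    [NeZero (NumberField.discr K).natAbs]
    (hf : IsNewformOf W f) (hN : (N : ℤ) = W.conductorNorm ℤ) (hp : p ≠ 2)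
    (hpN : ¬ (p : ℤ) ∣ W.conductorNorm ℤ) (hap : W.frobeniusTrace p = 0) (hK : IsImaginaryQuadratic K)
    (hsplit : ((Ideal.span {(p : ℤ)}).primesOver (𝓞 K)).ncard = 2) (hv : ((p : ℕ) : 𝓞 K) ∈ v.asIdeal)
    (hvbar : ((p : ℕ) : 𝓞 K) ∈ vbar.asIdeal) (hne : vbar ≠ v)
    (hι : ∀ (w : InfinitePlace K) (k : 𝓞 K), k ∈ v.asIdeal ↔ ‖ι.symm (w.embedding (k : K))‖ < 1)
    (hcop : IsCoprime (N : ℤ) (NumberField.discr K))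
    -- the datum of the line: `N` square-free, `D_K` odd, one bad prime `q₀` inert, the others split, (ram)
    (hsq : Squarefree N) (hodd : Odd (NumberField.discr K)) {q₀ : ℕ} (hq₀ : q₀.Prime) (hqN : q₀ ∣ N)
    (hin : ((Ideal.span {(q₀ : ℤ)}).primesOver (𝓞 K)).ncard = 1)
    (hspl : ∀ ℓ : ℕ, ℓ.Prime → ℓ ∣ N → ℓ ≠ q₀ → ((Ideal.span {(ℓ : ℤ)}).primesOver (𝓞 K)).ncard = 2)
    (hram : ¬ ((p : ℤ) ∣ padicValRat q₀ W.Δ))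
    (hirr : ∀ ρ : ModPGaloisRep K (ZMod p) 2, (W.baseChange K).IsTorsionGaloisRep p ρ →
      FramedRep.IsAbsolutelyIrreducible ρ)
    (hcyc : κ₁.IsCyclotomic) (hanti : κ₂.IsAnticyclotomic)
    (Ω δ : ℂ) (Ωp : (unrIntegers p)ˣ) (LK G : PowerSeries (PowerSeries (PadicComplexInt p)))
    (hΩ : Ω ≠ 0) (hδ : δ ^ 2 = (NumberField.discr K : ℂ) ∨ δ ^ 2 = -(NumberField.discr K : ℂ))
    (hLK : IsKatzMeasure₂ ι v vbar ∅ κ₁ κ₂ γ₁⁻¹ γ₂⁻¹ 1 Ω δ ((Ωp : unrIntegers p) : PadicComplex p) LK)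
    (hG : IsGreenbergLFunctionAnyRoot₂ ι v vbar κ₁ κ₂ γ₁⁻¹ γ₂⁻¹ f (NumberField.discr K).natAbs
      (NumberField.classNumber K) LK G)
    (J : ℤ_[p] →+* PadicComplexInt p)
    (hJ : ∀ x : ℤ_[p], ((J x : PadicComplexInt p) : PadicComplex p) = ((x : ℚ_[p]) : PadicComplex p))
    (ε : ℤˣ)
    -- a definite carrier of type `(N/q₀, q₀)`
    (S : Brandt.XiSetup (N / q₀) q₀) [Fintype (Brandt.ClassSet S.O)] (φ : Brandt.ClassSet S.O → ℤ)
    (hφ0 : φ ≠ 0)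
    (hφ : Brandt.eigenLattice (N / q₀ * q₀) (Brandt.matrix S.O) (fun n => W.LFunction n) = ℤ ∙ φ)
    (T : GrossPointTower K S p) :
    ∃ xi Lsig : PowerSeries (PowerSeries (PadicComplexInt p)),
      (∃ (S : Brandt.XiSetup (N / q₀) q₀) (_ : Fintype (Brandt.ClassSet S.O))
          (φ : Brandt.ClassSet S.O → ℤ) (T : GrossPointTower K S p),
          φ ≠ 0 ∧
          Brandt.eigenLattice (N / q₀ * q₀) (Brandt.matrix S.O) (fun n => W.LFunction n) = ℤ ∙ φ ∧
          (T.HasMuZeroLAc p φ → GreenbergVatsal2000.HasUnitContent (UnrSeries₂.minus Lsig))) ∧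
      (Ideal.span {xi * G} =
          (WeierstrassCurve.XGr₂.charIdeal (W.baseChange K) p κ₁ κ₂ vbar γ₁ γ₂).map
              (IwasawaAlgebra₂.toUnr₂ p J) * Ideal.span {Lsig} ∧
      ∀ (κ : ZpExtension ℚ p) (γ : absoluteGaloisGroup ℚ), κ.IsCyclotomic → κ.IsTopGenerator γ →
        IsCyclotomicVariable p γ →
        (∃ ζ : ℤ_[p]ˣ, IsOfFinOrder ζ ∧
          GaloisRep.cyclotomicCharacter ℚ p γ * ζ = GaloisRep.cyclotomicCharacter K p γ₁) →
        ∀ (W₂ : WeierstrassCurve ℚ) [W₂.IsElliptic] [W₂.IsGloballyMinimal]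
          (C₂ : WeierstrassCurve.VariableChange ℚ),
          C₂ • W₂ = W.quadraticTwist (NumberField.discr K : ℚ) →
          (∀ (D₁ : Kobayashi2003.SignedSelmerDualData W κ γ ε)
              (D₂ : Kobayashi2003.SignedSelmerDualData W₂ κ γ ε) (g₁ g₂ : IwasawaAlgebra p),
              D₁.charIdeal = Ideal.span {g₁} → D₂.charIdeal = Ideal.span {g₂} →
              UnrSeries₂.plus xi ∣ PowerSeries.map J (g₁ * g₂)) ∧
          (∀ {N₂ : ℕ} [NeZero N₂] (f₂ : CuspForm (Gamma0 N₂) 2), IsNewformOf W₂ f₂ →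
            ∀ (L₁ L₂ : IwasawaAlgebra p), Kobayashi2003.IsSignedPAdicLFunction f p ε L₁ →
              Kobayashi2003.IsSignedPAdicLFunction f₂ p ε L₂ →
              ∃ u : PowerSeries (PadicComplexInt p), IsUnit u ∧
                UnrSeries₂.plus Lsig = u * PowerSeries.map J (L₁ * L₂))) := by
  have hq2 : ¬ (q₀ ^ 2 ∣ N) := not_sq_dvd_of_squarefree_of_prime hsq hq₀
  have hmul : N / q₀ * q₀ = N := Nat.div_mul_cancel hqN
  have hplus : ∀ ℓ : ℕ, ℓ.Prime → ℓ ∣ N / q₀ →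
      ((Ideal.span {(ℓ : ℤ)}).primesOver (𝓞 K)).ncard = 2 := fun ℓ hℓ hℓd =>
    hspl ℓ hℓ (dvd_and_ne_of_dvd_div hqN hq2 hℓd).1 (dvd_and_ne_of_dvd_div hqN hq2 hℓd).2
  have hminus : ∀ ℓ : ℕ, ℓ.Prime → ℓ ∣ q₀ →
      ((Ideal.span {(ℓ : ℤ)}).primesOver (𝓞 K)).ncard = 1 := by
    intro ℓ hℓ hℓd
    obtain rfl := (Nat.prime_dvd_prime_iff_eq hℓ hq₀).mp hℓd
    exact hin
  have hram' : ∀ q : ℕ, q.Prime → q ∣ q₀ → ¬ ((p : ℤ) ∣ padicValRat q W.Δ) := by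
    intro q hq hqd
    obtain rfl := (Nat.prime_dvd_prime_iff_eq hq hq₀).mp hqd
    exact hram
  obtain ⟨xi, Lsig, hpin, hrest⟩ := h ι W K v vbar κ₁ κ₂ γ₁ γ₂ f hf hN hp hpN hap hK hsplit hv
    hvbar hne hι hcop hsq hodd (N / q₀) q₀ hmul hplus hminus hram' (odd_card_primeFactors_of_prime hq₀)
    hirr hcyc hanti Ω δ Ωp LK G hΩ hδ hLK hG J hJ ε
  exact ⟨xi, Lsig, ⟨S, ‹_›, φ, T, hφ0, hφ, hpin S φ T hφ0 hφ⟩, hrest⟩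

end Consumer

end Literature.NumberTheory.EllipticCurves.BurungaleSkinnerTianWan2024

end
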